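import Literature.Combinatorics.Designs.SequenceSumSquares

/-!
# Turyn-type sequences of odd length: the case `n ≡ 3 (mod 4)`

[Best–Đoković–Kharaghani–Ramp, J. Combin. Des. 21 (2013) = arXiv:1206.4107] (`BestDjokovicKharaghaniRamp2013`), §1:
"`TT(n)` do not exist for odd `n > 1`" (which is why only even `n` are classified and searched).  We record the half of
this statement that follows from the sum-of-squares condition alone: if `(x; y; z; w)` are `TT(n)` with `n` odd then
the element sums of `x, y, z` are odd and that of `w` (length `n - 1`) is even, so
`x² + y² + 2z² + 2w² ≡ 1 + 1 + 2 + 0 = 4 (mod 8)`, while `6n - 2 ≡ 0 (mod 8)` when `n ≡ 3 (mod 4)`; hence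
**`n ≢ 3 (mod 4)`** (`turynType_length_mod_four`).
-- TODO(general form): the case `n ≡ 1 (mod 4)`, `n > 1` (the published statement covers all odd `n > 1`; its proof is
-- not the sum-of-squares argument).
Cell pub-namedobj (venture DiscreteObjects), target H (the target length `56` is even; this is family bookkeeping).
No `sorry`, no new axioms.
-/

open Finset BigOperators

namespace Literature.Combinatorics.Designs.TurynTypeOddLength

open Literature.Combinatorics.Designs.TSequences
open Literature.Combinatorics.Designs.BaseSequences
open Literature.Combinatorics.Designs.SequenceSums

/-- a `±1` sum of length `L` is `L - 2k` for some integer `k`. [folklore] -/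
private theorem sum_pm_parity {x : ℕ → ℤ} : ∀ {L : ℕ}, PMOn L x → ∃ k : ℤ, ∑ i ∈ range L, x i = L - 2 * k
  | 0, _ => ⟨0, by simp⟩
  | L + 1, hx => by
      obtain ⟨k, hk⟩ := sum_pm_parity (L := L) fun i hi => hx i (Nat.lt_succ_of_lt hi)
      rw [Finset.sum_range_succ, hk]
      rcases hx L (Nat.lt_succ_self L) with h | h
      · exact ⟨k, by rw [h]; push_cast; ring⟩
      · exact ⟨k + 1, by rw [h]; push_cast; ring⟩

/-- the residue computation behind the theorem (all residues mod `8`). [folklore] -/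
private lemma key_mod_eight : ∀ q a b c d : ZMod 8,
    (4 * q + 3 - 2 * a) ^ 2 + (4 * q + 3 - 2 * b) ^ 2 + 2 * (4 * q + 3 - 2 * c) ^ 2 + 2 * (4 * q + 2 - 2 * d) ^ 2 ≠
      6 * (4 * q + 3) - 2 := by
  decide +kernel

/-- **No Turyn-type sequences `TT(n)` with `n ≡ 3 (mod 4)`** (the sum-of-squares half of "TT(n) do not exist for odd
n > 1"). [cite: BestDjokovicKharaghaniRamp2013, §1 (TT(n) do not exist for odd n > 1)] -/
theorem turynType_length_mod_four {n : ℕ} {x y z w : ℕ → ℤ} (h : IsTurynType n x y z w) : n % 4 ≠ 3 := by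
  intro h3
  have hsq := turynType_sum_sq h (by omega)
  obtain ⟨hx, hy, hz, hw, -⟩ := h
  obtain ⟨a, ha⟩ := sum_pm_parity hx
  obtain ⟨b, hb⟩ := sum_pm_parity hy
  obtain ⟨c, hc⟩ := sum_pm_parity hz
  obtain ⟨d, hd⟩ := sum_pm_parity hw
  obtain ⟨q, hq⟩ : ∃ q, n = 4 * q + 3 := ⟨n / 4, by omega⟩
  have hn1 : ((n - 1 : ℕ) : ℤ) = 4 * q + 2 := by
    have : n - 1 = 4 * q + 2 := by omega
    rw [this]; push_cast; ring
  rw [ha, hb, hc, hd, hn1, hq] at hsq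
  push_cast at hsq
  have hcast := congrArg (fun t : ℤ => (t : ZMod 8)) hsq
  push_cast at hcast
  exact key_mod_eight _ _ _ _ _ hcast

/-- existence form. [cite: BestDjokovicKharaghaniRamp2013, §1 (TT(n) do not exist for odd n > 1)] -/
theorem no_turynType_of_mod_four {n : ℕ} (hn : n % 4 = 3) : ¬ ∃ x y z w : ℕ → ℤ, IsTurynType n x y z w :=
  fun ⟨_, _, _, _, h⟩ => turynType_length_mod_four h hn

end Literature.Combinatorics.Designs.TurynTypeOddLength
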